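import Mathlib
import Literature.Probability.Percolation.PercolationProofs
import Literature.Probability.Percolation.StaticRenormalizationBlocks
import Literature.Probability.Percolation.BondPercolationSymmetry
import HarnessLib

/-!
# StochasticDomination

Topic `Literature/Probability/Percolation`. Named literature fact(s) relocated by the gate from `Summits/CriticalPhenomena/PercolationContinuityZ3/Theorems/PercBurnResprinkleVacantReignitionFreshDomination.lean`
(accept-time relocation of `[cite]`d propositions written inline in a Summits proposal; human ruling 2026-08-15).
Sources: LiggettSchonmannStacey1997.

* `Literature.Probability.Percolation.LiggettSchonmannStacey1997_dominatesProduct`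
-/

namespace Literature.Probability.Percolation

open MeasureTheory ProbabilityTheory Literature.Probability.Percolation Literature.Probability.LatticeModels
open scoped ENNReal

/-- **Liggett–Schonmann–Stacey 1997, Theorem 0.0 (i)–(ii)** (= Grimmett 1999, Thm (7.65)), in the
corollary form used by static (block) renormalisation arguments.  LSS: for each `d` and `k`, every
`k`-dependent family `(X_s)_{s ∈ ℤ^d}` of `{0,1}`-valued random variables (sub-families indexed by
sets `A, B ⊆ ℤ^d` at mutual `ℓ^∞`-distance `> k` are independent) with `P(X_s = 1) ≥ p` is
stochastically dominated from below by the product random field with some density `ρ(d, k, p)`, and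
`ρ(d, k, p) → 1` as `p → 1` (Cor. 1.4); domination `μ ≥ ν` means `∫ f dμ ≥ ∫ f dν` for continuous
increasing `f`, equivalently (their Lemma 1.0, Strassen) a monotone coupling, hence `ν(E) ≤ μ(E)` for
every increasing measurable event `E ⊆ {0,1}^{ℤ^d}`.  COROLLARY FORM stated here: for every range `M`
and every `ρ < 1` there is `δ > 0` such that every `M`-dependent family of events `X_x` (on any
probability space; `ℓ^∞`-distance = Mathlib's sup metric `dist` on `Fin d → ℤ`) with `P(X_x) ≥ 1 - δ`
dominates, on increasing measurable events of the random set `{x | X_x}` (`Set (Fin d → ℤ)` with its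
product σ-algebra), every INDEPENDENT family of events `Y_x` (on any other probability space) with
`P'(Y_x) ≤ ρ` — combine LSS (density `ρ' ≥ ρ` of the dominated product field for `p = 1 - δ` close to
`1`) with the trivial monotone coupling of product measures, `π_{ρ'} ≥ π_ρ ≥` law of `(Y_x)` (their
Lemma 1.1), and transitivity of domination.
[cite: LiggettSchonmannStacey1997, Thm 0.0] [file Probability/Percolation/StochasticDomination] -/
def LiggettSchonmannStacey1997_dominatesProduct : Prop :=
  ∀ (d M : ℕ) (ρ : ℝ), ρ < 1 → ∃ δ : ℝ, 0 < δ ∧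
    ∀ (Ω Ω' : Type) [MeasurableSpace Ω] [MeasurableSpace Ω']
      (P : MeasureTheory.Measure Ω) (P' : MeasureTheory.Measure Ω')
      [MeasureTheory.IsProbabilityMeasure P] [MeasureTheory.IsProbabilityMeasure P']
      (X : (Fin d → ℤ) → Set Ω) (Y : (Fin d → ℤ) → Set Ω'),
      (∀ x, MeasurableSet (X x)) → (∀ x, MeasurableSet (Y x)) →
      (∀ A B : Set (Fin d → ℤ), (∀ a ∈ A, ∀ b ∈ B, (M : ℝ) < dist a b) →
        ProbabilityTheory.Indep (MeasurableSpace.generateFrom (X '' A))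
          (MeasurableSpace.generateFrom (X '' B)) P) →
      (∀ x, 1 - δ ≤ P.real (X x)) →
      ProbabilityTheory.iIndepSet Y P' → (∀ x, P'.real (Y x) ≤ ρ) →
      ∀ E : Set (Set (Fin d → ℤ)), IsUpperSet E → MeasurableSet E →
        P'.real {ω' | {x | ω' ∈ Y x} ∈ E} ≤ P.real {ω | {x | ω ∈ X x} ∈ E}

end Literature.Probability.Percolation
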